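import Literature.Topology.FourManifolds.BordismFourThomInvariantKernel
import HarnessLib

/-!
# Thom's generators of `𝔑₄`: the invariant `(χ mod 2, v₁⁴)` is onto `(ℤ/2)²`, and `|𝔑₄| = 4`
# says exactly that every closed 4-manifold is bordant mod 2 to one of `∅, ℂℙ², ℝℙ⁴, ℂℙ² ⊔ ℝℙ⁴`

R. Thom, *Quelques propriétés globales des variétés différentiables*, Comment. Math. Helv. 28
(1954), Thm IV.12 and "Les générateurs pour les petites dimensions" (pp. 79–80): "Pour `k = 4` …
le groupe `𝔑⁴` est isomorphe à `ℤ₂ + ℤ₂`", generated by the classes of `PR(4)` and `PR(2)²`,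
and "`PC(2)` est cobordant mod 2 au carré du plan projectif réel `PR(2)`" — so `𝔑⁴` is the set
of the four classes `0, [PC(2)], [PR(4)], [PC(2)] + [PR(4)]`, told apart by the two
Stiefel–Whitney numbers `w₄ = χ mod 2` and `w₁⁴` (Thm IV.3, IV.10).

The tree has Thom's invariant `UnorientedBordismClass.thomInvariant = (χ mod 2, v₁⁴[·]) :
𝔑₄ → ℤ/2 × ℤ/2` (`BordismFourUnorientedCount.lean`), additive (`thomInvariant_add`), with
`thomInvariant [ℂℙ²] = (1, 0)` and `v₁⁴[ℝℙ⁴] = 1` (`BordismFourRealProjectiveFour.lean`), and the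
lossless reduction `|𝔑₄| = 4 ↔ thomInvariant injective`
(`natCard_unorientedBordismClass_four_iff_injective_thomInvariant`,
`BordismFourThomInvariantKernel.lean`).  This file adds the GENERATORS half of Thm IV.12 at
`k = 4`, which is provable now, and the resulting verbatim form of the remaining half:

* §1 `UnorientedBordismClass.exists_generated_thomInvariant_eq`,
  **`UnorientedBordismClass.thomInvariant_surjective`** — every value in `(ℤ/2)²` is the
  invariant of one of `0, [ℂℙ²], [ℝℙ⁴], [ℂℙ²] + [ℝℙ⁴]` (their invariants are `(0,0)`, `(1,0)`,
  `(x,1)`, `(1+x,1)` with `x = χ(ℝℙ⁴) mod 2`, a basis of `(ℤ/2)²` whatever `x` is); with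
  `UnorientedBordismClass.bijOn_thomInvariant_generated`: Thom's invariant maps these four classes
  bijectively onto `(ℤ/2)²` — the subgroup they form is `ℤ₂ + ℤ₂` (Thom, p. 79);
* §2 `UnorientedBordismClass.exists_generated_thomInvariant_add_eq_zero` — every class of `𝔑₄`
  differs from one of the four by a class with vanishing invariant (`𝔑₄ = ⟨[ℂℙ²], [ℝℙ⁴]⟩ + ker`);
* §3 **`natCard_unorientedBordismClass_four_iff_forall_mem_generated`** and the manifold form
  **`natCard_unorientedBordismClass_four_iff_forall_mk_eq`**: `|𝔑₄| = 4` ↔ *every closed smooth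
  4-manifold is bordant mod 2 to exactly one of `∅`, `ℂℙ²`, `ℝℙ⁴`, `ℂℙ² ⊔ ℝℙ⁴`* — Thom's
  statement of pp. 79–80 at `k = 4` (with `PC(2)` for `PR(2)²`), losslessly;
* §4 `natCard_unorientedBordismClass_four_iff_bijective_thomInvariant` — equivalently Thom's
  invariant is an isomorphism `𝔑₄ ≅ ℤ₂ + ℤ₂` (Thm IV.12); only injectivity (Thm IV.10 at
  `k = 4`, the Pontryagin–Thom computation) is not in the tree.

Everything here is proved; no definitions, no named facts (D-0026); written in support of
`Literature.Topology.FourManifolds.natCard_unorientedBordismClass_four`.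

## References

* R. Thom, *Quelques propriétés globales des variétés différentiables*, Comment. Math. Helv. 28
  (1954), 17–86: Thm IV.3 (p. 66), Thm IV.10 and Cor. IV.11 (p. 77), Thm IV.12 and "Les
  générateurs pour les petites dimensions" (pp. 79–80). [ThomCMH1954]
* J. W. Milnor, J. D. Stasheff, *Characteristic Classes*, Ann. of Math. Studies 76 (1974), §4
  (p. 51: `ℝℙ⁴` does not bound; Thm. 4.9–4.10), §17. [MilnorStasheff1974]
-/

noncomputable section

open scoped Manifold ContDiff
open Set Function
open Literature.AlgebraicTopology.SingularHomology

namespace Literature.Topology.FourManifolds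

/-! ### Two-element arithmetic in `ℤ/2` -/

/-- In `ℤ/2` a nonzero element is `1`. [folklore] -/
private lemma zmod_two_eq_one_of_ne_zero {p : ZMod 2} (h : p ≠ 0) : p = 1 := by
  revert h p; decide

/-- In `ℤ/2` two distinct elements differ by `1`. [folklore] -/
private lemma zmod_two_eq_one_add_of_ne {p x : ZMod 2} (h : p ≠ x) : p = 1 + x := by
  revert h p x; decide

/-! ### §1 Thom's invariant is onto `(ℤ/2)²`: the four classes `0, [ℂℙ²], [ℝℙ⁴], [ℂℙ²] + [ℝℙ⁴]` -/

/-- `v₁⁴` of `[ℝℙ⁴]`, read as the second coordinate of Thom's invariant: `(thomInvariant [ℝℙ⁴]).2 = 1`.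
[cite: ThomCMH1954, Thm IV.12 and pp. 79–80] -/
theorem UnorientedBordismClass.thomInvariant_mk_realProjectiveSpace_four_snd :
    (UnorientedBordismClass.thomInvariant
      (UnorientedBordismClass.mk (RealProjectiveSpace 4) : UnorientedBordismClass.{0} 4)).2 = 1 :=
  UnorientedBordismClass.wuNumberOnePowFour_mk_realProjectiveSpace_four

/-- **`thomInvariant ([ℂℙ²] + [ℝℙ⁴]) = (1 + χ₂[ℝℙ⁴], 1)`** (additivity, `thomInvariant [ℂℙ²] = (1, 0)`,
`v₁⁴[ℝℙ⁴] = 1`). [cite: ThomCMH1954, Ch. IV §2 (p. 65), Thm IV.12 and pp. 79–80] -/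
theorem UnorientedBordismClass.thomInvariant_mk_complexProjectivePlane_add_mk_realProjectiveSpace_four :
    haveI := ClosedSingularManifold.bordismFacts_succ (Y := PUnit.{1}) (n := 3)
    UnorientedBordismClass.thomInvariant
      ((UnorientedBordismClass.mk ComplexProjectivePlane : UnorientedBordismClass.{0} 4) +
        UnorientedBordismClass.mk (RealProjectiveSpace 4)) =
      (1 + (UnorientedBordismClass.thomInvariant
        (UnorientedBordismClass.mk (RealProjectiveSpace 4) : UnorientedBordismClass.{0} 4)).1, 1) := by
  haveI := ClosedSingularManifold.bordismFacts_succ (Y := PUnit.{1}) (n := 3)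
  rw [UnorientedBordismClass.thomInvariant_add,
    UnorientedBordismClass.thomInvariant_mk_complexProjectivePlane]
  refine Prod.ext rfl ?_
  change (0 : ZMod 2) + (UnorientedBordismClass.thomInvariant
    (UnorientedBordismClass.mk (RealProjectiveSpace 4) : UnorientedBordismClass.{0} 4)).2 = 1
  rw [UnorientedBordismClass.thomInvariant_mk_realProjectiveSpace_four_snd, zero_add]

/-- **Every value in `(ℤ/2)²` is Thom's invariant of one of `0, [ℂℙ²], [ℝℙ⁴], [ℂℙ²] + [ℝℙ⁴]`**:
their invariants `(0, 0)`, `(1, 0)`, `(x, 1)`, `(1 + x, 1)` (`x = χ(ℝℙ⁴) mod 2`) exhaust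
`ℤ/2 × ℤ/2` — Thom 1954, p. 79: the classes of `PC(2) ∼ PR(2)²` and `PR(4)` generate a group
`ℤ₂ + ℤ₂` detected by the numbers `w₄`, `w₁⁴`. [cite: ThomCMH1954, Thm IV.12 and pp. 79–80] -/
theorem UnorientedBordismClass.exists_generated_thomInvariant_eq (v : ZMod 2 × ZMod 2) :
    haveI := ClosedSingularManifold.bordismFacts_succ (Y := PUnit.{1}) (n := 3)
    ∃ g : UnorientedBordismClass.{0} 4,
      (g = 0 ∨ g = UnorientedBordismClass.mk ComplexProjectivePlane ∨
        g = UnorientedBordismClass.mk (RealProjectiveSpace 4) ∨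
        g = UnorientedBordismClass.mk ComplexProjectivePlane +
          UnorientedBordismClass.mk (RealProjectiveSpace 4)) ∧
      UnorientedBordismClass.thomInvariant g = v := by
  haveI := ClosedSingularManifold.bordismFacts_succ (Y := PUnit.{1}) (n := 3)
  set b : UnorientedBordismClass.{0} 4 := UnorientedBordismClass.mk ComplexProjectivePlane with hbdef
  set c : UnorientedBordismClass.{0} 4 := UnorientedBordismClass.mk (RealProjectiveSpace 4) with hcdef
  have hb : UnorientedBordismClass.thomInvariant b = (1, 0) :=
    UnorientedBordismClass.thomInvariant_mk_complexProjectivePlane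
  have hc : UnorientedBordismClass.thomInvariant c = ((UnorientedBordismClass.thomInvariant c).1, 1) :=
    Prod.ext rfl UnorientedBordismClass.thomInvariant_mk_realProjectiveSpace_four_snd
  have hbc : UnorientedBordismClass.thomInvariant (b + c) =
      (1 + (UnorientedBordismClass.thomInvariant c).1, 1) :=
    UnorientedBordismClass.thomInvariant_mk_complexProjectivePlane_add_mk_realProjectiveSpace_four
  obtain ⟨p, q⟩ := v
  by_cases hq : q = 0
  · subst hq
    by_cases hp : p = 0
    · subst hp
      exact ⟨0, Or.inl rfl, UnorientedBordismClass.thomInvariant_zero⟩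
    · exact ⟨b, Or.inr (Or.inl rfl), by rw [hb, zmod_two_eq_one_of_ne_zero hp]⟩
  · have hq1 : q = 1 := zmod_two_eq_one_of_ne_zero hq
    subst hq1
    by_cases hp : p = (UnorientedBordismClass.thomInvariant c).1
    · exact ⟨c, Or.inr (Or.inr (Or.inl rfl)), by rw [hc, hp]⟩
    · exact ⟨b + c, Or.inr (Or.inr (Or.inr rfl)), by rw [hbc, zmod_two_eq_one_add_of_ne hp]⟩

/-- **Thom's invariant `(χ mod 2, v₁⁴) : 𝔑₄ → ℤ/2 × ℤ/2` is surjective** — the generators half of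
Thom's Thm IV.12 at `k = 4` (`𝔑⁴ ≅ ℤ₂ + ℤ₂`, generators `PR(4)` and `PR(2)² ∼ PC(2)`): the two
Stiefel–Whitney numbers `w₄`, `w₁⁴` take all four values on `∅, ℂℙ², ℝℙ⁴, ℂℙ² ⊔ ℝℙ⁴`.  (The other
half, injectivity, is Thm IV.10 at `k = 4`, the Pontryagin–Thom computation, not in the tree.)
[cite: ThomCMH1954, Thm IV.12 and pp. 79–80] [cite: MilnorStasheff1974, §4 p. 51] -/
theorem UnorientedBordismClass.thomInvariant_surjective :
    Function.Surjective
      (UnorientedBordismClass.thomInvariant : UnorientedBordismClass.{0} 4 → ZMod 2 × ZMod 2) :=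
  fun v => by
    obtain ⟨g, -, hg⟩ := UnorientedBordismClass.exists_generated_thomInvariant_eq v
    exact ⟨g, hg⟩

/-- **The four classes `0, [ℂℙ²], [ℝℙ⁴], [ℂℙ²] + [ℝℙ⁴]` are mapped bijectively onto `ℤ/2 × ℤ/2` by
Thom's invariant**: the subgroup of `𝔑₄` generated by `[ℂℙ²]` and `[ℝℙ⁴]` is `ℤ₂ + ℤ₂`, detected by
`(w₄, w₁⁴)` (Thom 1954, p. 79). [cite: ThomCMH1954, Thm IV.12 and pp. 79–80] -/
theorem UnorientedBordismClass.bijOn_thomInvariant_generated :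
    haveI := ClosedSingularManifold.bordismFacts_succ (Y := PUnit.{1}) (n := 3)
    Set.BijOn (UnorientedBordismClass.thomInvariant : UnorientedBordismClass.{0} 4 → ZMod 2 × ZMod 2)
      {0, UnorientedBordismClass.mk ComplexProjectivePlane,
        UnorientedBordismClass.mk (RealProjectiveSpace 4),
        UnorientedBordismClass.mk ComplexProjectivePlane +
          UnorientedBordismClass.mk (RealProjectiveSpace 4)}
      Set.univ := by
  haveI := ClosedSingularManifold.bordismFacts_succ (Y := PUnit.{1}) (n := 3)
  set b : UnorientedBordismClass.{0} 4 := UnorientedBordismClass.mk ComplexProjectivePlane with hbdef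
  set c : UnorientedBordismClass.{0} 4 := UnorientedBordismClass.mk (RealProjectiveSpace 4) with hcdef
  have hb : UnorientedBordismClass.thomInvariant b = (1, 0) :=
    UnorientedBordismClass.thomInvariant_mk_complexProjectivePlane
  have hc : UnorientedBordismClass.thomInvariant c = ((UnorientedBordismClass.thomInvariant c).1, 1) :=
    Prod.ext rfl UnorientedBordismClass.thomInvariant_mk_realProjectiveSpace_four_snd
  have hbc : UnorientedBordismClass.thomInvariant (b + c) =
      (1 + (UnorientedBordismClass.thomInvariant c).1, 1) :=
    UnorientedBordismClass.thomInvariant_mk_complexProjectivePlane_add_mk_realProjectiveSpace_four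
  have h0 : UnorientedBordismClass.thomInvariant (0 : UnorientedBordismClass.{0} 4) = (0, 0) :=
    UnorientedBordismClass.thomInvariant_zero
  refine ⟨fun _ _ => Set.mem_univ _, ?_, ?_⟩
  · -- injectivity on the four classes: their invariants are pairwise distinct (`x = 0` or `1`)
    have hx : (UnorientedBordismClass.thomInvariant c).1 = 0 ∨
        (UnorientedBordismClass.thomInvariant c).1 = 1 := by
      generalize (UnorientedBordismClass.thomInvariant c).1 = y
      revert y; decide
    intro g hg g' hg' hgg'
    simp only [Set.mem_insert_iff, Set.mem_singleton_iff] at hg hg'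
    rcases hx with hx | hx <;> rw [hx] at hc hbc <;>
      rcases hg with rfl | rfl | rfl | rfl <;> rcases hg' with rfl | rfl | rfl | rfl <;>
      first
        | rfl
        | (exfalso
           simp only [h0, hb, hc, hbc] at hgg'
           exact absurd hgg' (by decide))
  · -- surjectivity onto `univ`
    intro v _
    obtain ⟨g, hg, hgv⟩ := UnorientedBordismClass.exists_generated_thomInvariant_eq v
    refine ⟨g, ?_, hgv⟩
    simp only [Set.mem_insert_iff, Set.mem_singleton_iff]
    exact hg

/-! ### §2 Every class differs from one of the four generators' classes by a kernel element -/

/-- **`𝔑₄ = {0, [ℂℙ²], [ℝℙ⁴], [ℂℙ²] + [ℝℙ⁴]} + ker (χ mod 2, v₁⁴)`**: for every `a ∈ 𝔑₄` one of the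
four classes `g` has `thomInvariant (a + g) = 0` (surjectivity on the four classes and additivity;
`v + v = 0` in `(ℤ/2)²`).  Thom's Thm IV.10 at `k = 4` is the statement that this kernel is `0`.
[cite: ThomCMH1954, Thm IV.10 (p. 77), Thm IV.12 and pp. 79–80] -/
theorem UnorientedBordismClass.exists_generated_thomInvariant_add_eq_zero (a : UnorientedBordismClass.{0} 4) :
    haveI := ClosedSingularManifold.bordismFacts_succ (Y := PUnit.{1}) (n := 3)
    ∃ g : UnorientedBordismClass.{0} 4,
      (g = 0 ∨ g = UnorientedBordismClass.mk ComplexProjectivePlane ∨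
        g = UnorientedBordismClass.mk (RealProjectiveSpace 4) ∨
        g = UnorientedBordismClass.mk ComplexProjectivePlane +
          UnorientedBordismClass.mk (RealProjectiveSpace 4)) ∧
      UnorientedBordismClass.thomInvariant (a + g) = 0 := by
  haveI := ClosedSingularManifold.bordismFacts_succ (Y := PUnit.{1}) (n := 3)
  obtain ⟨g, hg, hgv⟩ :=
    UnorientedBordismClass.exists_generated_thomInvariant_eq (UnorientedBordismClass.thomInvariant a)
  refine ⟨g, hg, ?_⟩
  rw [UnorientedBordismClass.thomInvariant_add, hgv]
  exact Prod.ext (CharTwo.add_self_eq_zero _) (CharTwo.add_self_eq_zero _)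

/-! ### §3 `|𝔑₄| = 4` ↔ every closed 4-manifold is bordant mod 2 to one of `∅, ℂℙ², ℝℙ⁴, ℂℙ² ⊔ ℝℙ⁴` -/

/-- **`|𝔑₄| = 4 ↔ 𝔑₄ = {0, [ℂℙ²], [ℝℙ⁴], [ℂℙ²] + [ℝℙ⁴]}`** — Thom's description of `𝔑⁴` on
pp. 79–80 (`ℤ₂ + ℤ₂` on the generators `PR(4)`, `PR(2)² ∼ PC(2)`), losslessly equivalent to the
count.  (`→`: the count makes Thom's invariant injective,
`UnorientedBordismClass.injective_thomInvariant_of_natCard_eq_four`, and every value is attained on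
the four classes; `←`: a class with zero invariant among the four is `0`, so the invariant is
injective, `natCard_unorientedBordismClass_four_of_injective`.) [cite: ThomCMH1954, Thm IV.12 and pp. 79–80] -/
theorem natCard_unorientedBordismClass_four_iff_forall_mem_generated :
    haveI := ClosedSingularManifold.bordismFacts_succ (Y := PUnit.{1}) (n := 3)
    natCard_unorientedBordismClass_four ↔
      ∀ a : UnorientedBordismClass.{0} 4,
        a = 0 ∨ a = UnorientedBordismClass.mk ComplexProjectivePlane ∨
          a = UnorientedBordismClass.mk (RealProjectiveSpace 4) ∨
          a = UnorientedBordismClass.mk ComplexProjectivePlane +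
            UnorientedBordismClass.mk (RealProjectiveSpace 4) := by
  haveI := ClosedSingularManifold.bordismFacts_succ (Y := PUnit.{1}) (n := 3)
  constructor
  · intro h a
    have hinj := UnorientedBordismClass.injective_thomInvariant_of_natCard_eq_four h
    obtain ⟨g, hg, hgv⟩ :=
      UnorientedBordismClass.exists_generated_thomInvariant_eq (UnorientedBordismClass.thomInvariant a)
    rw [← hinj hgv]
    exact hg
  · intro h
    refine natCard_unorientedBordismClass_four_of_injective
      (UnorientedBordismClass.injective_thomInvariant_iff.2 fun a ha => ?_)
    have hb : UnorientedBordismClass.thomInvariant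
        (UnorientedBordismClass.mk ComplexProjectivePlane : UnorientedBordismClass.{0} 4) = (1, 0) :=
      UnorientedBordismClass.thomInvariant_mk_complexProjectivePlane
    have hc2 := UnorientedBordismClass.thomInvariant_mk_realProjectiveSpace_four_snd
    have hbc :=
      UnorientedBordismClass.thomInvariant_mk_complexProjectivePlane_add_mk_realProjectiveSpace_four
    rcases h a with rfl | rfl | rfl | rfl
    · rfl
    · exfalso
      rw [hb] at ha
      exact one_ne_zero (congrArg Prod.fst ha)
    · exfalso
      rw [ha] at hc2
      exact zero_ne_one hc2
    · exfalso
      rw [ha] at hbc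
      exact zero_ne_one (congrArg Prod.snd hbc)

/-- **`|𝔑₄| = 4` ↔ every closed smooth 4-manifold `M` is bordant mod 2 to one of `∅`, `ℂℙ²`,
`ℝℙ⁴`, `ℂℙ² ⊔ ℝℙ⁴`** — Thom's Thm IV.12 at `k = 4` with "Les générateurs pour les petites
dimensions" (pp. 79–80: representatives `PR(4)`, `PR(2)²`, and `PC(2) ∼ PR(2)²`), in the language
of manifolds (`[M ⊔ N] = [M] + [N]`, `UnorientedBordismClass.mk_sum`); a lossless restatement of
the target. [cite: ThomCMH1954, Thm IV.12 and pp. 79–80] -/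
theorem natCard_unorientedBordismClass_four_iff_forall_mk_eq :
    natCard_unorientedBordismClass_four ↔
      ∀ (M : Type) [TopologicalSpace M] [T2Space M] [ChartedSpace (EuclideanSpace ℝ (Fin 4)) M]
        [IsManifold (𝓡 4) ∞ M] [CompactSpace M] [BoundarylessManifold (𝓡 4) M],
        (UnorientedBordismClass.mk M : UnorientedBordismClass.{0} 4) = 0 ∨
          (UnorientedBordismClass.mk M : UnorientedBordismClass.{0} 4) =
            UnorientedBordismClass.mk ComplexProjectivePlane ∨
          (UnorientedBordismClass.mk M : UnorientedBordismClass.{0} 4) =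
            UnorientedBordismClass.mk (RealProjectiveSpace 4) ∨
          (UnorientedBordismClass.mk M : UnorientedBordismClass.{0} 4) =
            UnorientedBordismClass.mk (ComplexProjectivePlane ⊕ RealProjectiveSpace 4) := by
  haveI := ClosedSingularManifold.bordismFacts_succ (Y := PUnit.{1}) (n := 3)
  rw [natCard_unorientedBordismClass_four_iff_forall_mem_generated,
    ← UnorientedBordismClass.mk_sum]
  constructor
  · intro h M _ _ _ _ _ _
    exact h _
  · intro h a
    induction a using BordismClass.ind with | h s => ?_
    rw [← UnorientedBordismClass.mk_carrier]
    exact h s.M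

/-! ### §4 `|𝔑₄| = 4` ↔ Thom's invariant is an isomorphism onto `ℤ₂ + ℤ₂` -/

/-- **`|𝔑₄| = 4 ↔ (χ mod 2, v₁⁴) : 𝔑₄ → ℤ/2 × ℤ/2` is bijective** (Thom 1954, Thm IV.12:
`𝔑⁴ ≅ ℤ₂ + ℤ₂` through the Stiefel–Whitney numbers `w₄`, `w₁⁴`): surjectivity is proved
(`UnorientedBordismClass.thomInvariant_surjective`); injectivity is Thm IV.10 at `k = 4`.
[cite: ThomCMH1954, Thm IV.10 (p. 77), Thm IV.12 and pp. 79–80] -/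
theorem natCard_unorientedBordismClass_four_iff_bijective_thomInvariant :
    natCard_unorientedBordismClass_four ↔
      Function.Bijective
        (UnorientedBordismClass.thomInvariant : UnorientedBordismClass.{0} 4 → ZMod 2 × ZMod 2) := by
  rw [natCard_unorientedBordismClass_four_iff_injective_thomInvariant]
  exact ⟨fun h => ⟨h, UnorientedBordismClass.thomInvariant_surjective⟩, fun h => h.1⟩

end Literature.Topology.FourManifolds
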